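import Summits.CriticalPhenomena.PercolationContinuityZ3.Theorems.PercNearOneGluingNoHeavyLowerTailKnQuestion8CoefficientwiseOffCluster

/-!
# Cluster identities for a thread of length 2 (digon removal, part 1: the graph lemmas)

Support file (`--supports stmt-CriticalPhenomena-4575`, closed), prover `prim-cplus-coupling` (gen 70).  No definitions, no named facts, no sorries;
standard axioms.  Memo `prim-cplus-coupling/A5-COUPLING-gen70.md` §8 and `THEOREM-IET-DIGON.md` (the DIGON REMOVAL theorem: CONJECTURE IET passes
from a bundle `Θ'` to `Θ' +` a thread `u – m – b` of length 2).

The proof of the digon removal theorem slices the colourings of `Θ' + {um, mb}` by the four colour states of the two new edges and compares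
the red/blue hub clusters with those of `Θ'` (mixed states) and of the chorded bundle `Θ' + {ub}` (pure states).  This file proves the three
set identities behind that comparison, for an arbitrary set `S` of edges (unordered pairs) not meeting the fresh vertex `m`:

* `openCluster_insert_rootLeaf_set`  — `C_u(S ∪ {um}) = C_u(S) ∪ {m}`;
* `openCluster_insert_farLeaf_set`   — `C_u(S ∪ {mb}) = C_u(S) ∪ {m | b ∈ C_u(S)}`;
* `openCluster_subdivide`            — `C_u(S ∪ {um, mb}) = C_u(S ∪ {ub}) ∪ {m}`.

Tools: the walk-transfer lemma `Coefficientwise.reachable_transfer` (closed-set arguments) and `Reachable.trans`.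
[cite: KozmaNitzan2024, Questions 8–9 (§5.5 p. 36) (context); Harris 1960]
-/

namespace Summit.CriticalPhenomena.PercolationContinuityZ3.Theorems.Coefficientwise.DigonClusters

open Literature.Probability.Percolation

variable {V : Type*}

/-- Closed-set principle for clusters: a set containing the root and closed under the open edges contains the cluster (via `reachable_transfer`). -/
theorem openCluster_subset_of_adj_closed (ω : Set (Sym2 V)) (x : V) (W : Set V) (hx : x ∈ W)
    (hW : ∀ a ∈ W, ∀ c, (openGraph ω).Adj a c → c ∈ W) : openCluster ω x ⊆ W := by
  intro y hy
  obtain ⟨p⟩ := hy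
  exact ((reachable_transfer W (G₂ := openGraph ω) (fun a ha c hac => ⟨hac, hW a ha c hac⟩) p) hx).2

/-- **Pendant edge at the root.**  If no edge of `S` meets `m` and `m ≠ u`, then adding the edge `um` adds exactly `m` to the cluster of `u`. -/
theorem openCluster_insert_rootLeaf_set (S : Set (Sym2 V)) (u m : V) (hmu : m ≠ u) (hfresh : ∀ z ∈ S, m ∉ z) :
    openCluster (insert s(u, m) S) u = insert m (openCluster S u) := by
  apply Set.Subset.antisymm
  · refine openCluster_subset_of_adj_closed _ u _ (Set.mem_insert_of_mem _ (mem_openCluster_self S u)) ?_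
    intro a ha c hac
    rw [openGraph_adj] at hac
    obtain ⟨hmem, hne⟩ := hac
    rcases Set.mem_insert_iff.mp hmem with heq | hS
    · -- the new edge: {a,c} = {u,m}
      rcases Sym2.eq_iff.mp heq with ⟨rfl, rfl⟩ | ⟨rfl, rfl⟩
      · exact Set.mem_insert _ _
      · exact Set.mem_insert_of_mem _ (mem_openCluster_self S _)
    · -- an old edge: `a ≠ m`, so `a ∈ C_u(S)` and `c ∈ C_u(S)`
      rcases Set.mem_insert_iff.mp ha with rfl | ha'
      · exact absurd (Sym2.mem_mk_left a c) (hfresh _ hS)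
      · have hadj : (openGraph S).Adj a c := by rw [openGraph_adj]; exact ⟨hS, hne⟩
        exact Set.mem_insert_of_mem _ (SimpleGraph.Reachable.trans ha' hadj.reachable)
  · intro y hy
    rcases Set.mem_insert_iff.mp hy with rfl | hy'
    · have hadj : (openGraph (insert s(u, y) S)).Adj u y := by
        rw [openGraph_adj]; exact ⟨Set.mem_insert _ _, fun h => hmu h.symm⟩
      exact hadj.reachable
    · exact openCluster_mono (Set.subset_insert _ _) u hy'

/-- **Pendant edge away from the root.**  If no edge of `S` meets `m`, `m ≠ u` and `m ≠ b`, then adding the edge `mb` adds `m` to the cluster of `u`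
iff `b` already belongs to it, and nothing else. -/
theorem openCluster_insert_farLeaf_set (S : Set (Sym2 V)) (u m b : V) (hmu : m ≠ u) (hmb : m ≠ b) (hfresh : ∀ z ∈ S, m ∉ z) :
    openCluster (insert s(m, b) S) u = openCluster S u ∪ {v | v = m ∧ b ∈ openCluster S u} := by
  apply Set.Subset.antisymm
  · refine openCluster_subset_of_adj_closed _ u _ (Or.inl (mem_openCluster_self S u)) ?_
    intro a ha c hac
    rw [openGraph_adj] at hac
    obtain ⟨hmem, hne⟩ := hac
    rcases Set.mem_insert_iff.mp hmem with heq | hS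
    · -- the new edge: {a,c} = {m,b}
      rcases Sym2.eq_iff.mp heq with ⟨rfl, rfl⟩ | ⟨rfl, rfl⟩
      · -- a = m, c = b: `m ∈ W` forces `b ∈ C_u(S)`
        rcases ha with ha' | ⟨_, hb⟩
        · exact absurd ha' (fun hm => by
            -- m ∈ C_u(S) is impossible: m ≠ u and no S-edge meets m
            have hsub : openCluster S u ⊆ {v | v ≠ a} := by
              refine openCluster_subset_of_adj_closed S u {v | v ≠ a} (fun h => hmu h.symm) ?_
              intro p _ q hpq hqa
              rw [openGraph_adj] at hpq
              exact hfresh _ hpq.1 (hqa ▸ Sym2.mem_mk_right p q)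
            exact (hsub hm) rfl)
        · exact Or.inl hb
      · -- a = b, c = m
        rcases ha with ha' | ⟨hbm, _⟩
        · exact Or.inr ⟨rfl, ha'⟩
        · exact absurd hbm hmb.symm
    · rcases ha with ha' | ⟨rfl, _⟩
      · have hadj : (openGraph S).Adj a c := by rw [openGraph_adj]; exact ⟨hS, hne⟩
        exact Or.inl (SimpleGraph.Reachable.trans ha' hadj.reachable)
      · exact absurd (Sym2.mem_mk_left a c) (hfresh _ hS)
  · rintro y (hy | ⟨rfl, hb⟩)
    · exact openCluster_mono (Set.subset_insert _ _) u hy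
    · have hb' : b ∈ openCluster (insert s(y, b) S) u := openCluster_mono (Set.subset_insert _ _) u hb
      have hadj : (openGraph (insert s(y, b) S)).Adj b y := by
        rw [openGraph_adj]; exact ⟨Sym2.eq_swap ▸ Set.mem_insert _ _, fun h => hmb (h.symm)⟩
      exact SimpleGraph.Reachable.trans hb' hadj.reachable

/-- **Subdivision of the chord.**  If no edge of `S` meets `m` and `m ≠ u`, `m ≠ b`, `u ≠ b`, then the cluster of `u` with the path `u – m – b` added is
the cluster of `u` with the chord `ub` added, plus `m`. -/
theorem openCluster_subdivide (S : Set (Sym2 V)) (u m b : V) (hmu : m ≠ u) (hmb : m ≠ b) (hub : u ≠ b) (hfresh : ∀ z ∈ S, m ∉ z) :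
    openCluster (insert s(u, m) (insert s(m, b) S)) u = insert m (openCluster (insert s(u, b) S) u) := by
  -- notation
  set ω₂ : Set (Sym2 V) := insert s(u, m) (insert s(m, b) S) with hω₂
  set ω₁ : Set (Sym2 V) := insert s(u, b) S with hω₁
  have hm₂ : m ∈ openCluster ω₂ u := by
    have hadj : (openGraph ω₂).Adj u m := by rw [openGraph_adj]; exact ⟨Set.mem_insert _ _, fun h => hmu h.symm⟩
    exact hadj.reachable
  have hb₂ : b ∈ openCluster ω₂ u := by
    have hadj : (openGraph ω₂).Adj m b := by
      rw [openGraph_adj]; exact ⟨Set.mem_insert_of_mem _ (Set.mem_insert _ _), hmb⟩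
    exact SimpleGraph.Reachable.trans hm₂ hadj.reachable
  have hb₁ : b ∈ openCluster ω₁ u := by
    have hadj : (openGraph ω₁).Adj u b := by rw [openGraph_adj]; exact ⟨Set.mem_insert _ _, hub⟩
    exact hadj.reachable
  apply Set.Subset.antisymm
  · -- `insert m (C_u ω₁)` contains `u` and is closed under the edges of `ω₂`
    refine openCluster_subset_of_adj_closed ω₂ u _ (Set.mem_insert_of_mem _ (mem_openCluster_self ω₁ u)) ?_
    intro a ha c hac
    rw [openGraph_adj] at hac
    obtain ⟨hmem, hne⟩ := hac
    rcases Set.mem_insert_iff.mp hmem with heq | hmem'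
    · -- edge um
      rcases Sym2.eq_iff.mp heq with ⟨rfl, rfl⟩ | ⟨rfl, rfl⟩
      · exact Set.mem_insert _ _
      · exact Set.mem_insert_of_mem _ (mem_openCluster_self ω₁ _)
    rcases Set.mem_insert_iff.mp hmem' with heq | hS
    · -- edge mb
      rcases Sym2.eq_iff.mp heq with ⟨rfl, rfl⟩ | ⟨rfl, rfl⟩
      · exact Set.mem_insert_of_mem _ hb₁
      · exact Set.mem_insert _ _
    · -- an old edge: a ≠ m
      rcases Set.mem_insert_iff.mp ha with rfl | ha'
      · exact absurd (Sym2.mem_mk_left a c) (hfresh _ hS)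
      · have hadj : (openGraph ω₁).Adj a c := by rw [openGraph_adj]; exact ⟨Set.mem_insert_of_mem _ hS, hne⟩
        exact Set.mem_insert_of_mem _ (SimpleGraph.Reachable.trans ha' hadj.reachable)
  · -- `C_u ω₂` contains `u`, `m`, `b` and is closed under the edges of `ω₁`
    intro y hy
    rcases Set.mem_insert_iff.mp hy with rfl | hy'
    · exact hm₂
    · refine openCluster_subset_of_adj_closed ω₁ u (openCluster ω₂ u) (mem_openCluster_self ω₂ u) ?_ hy'
      intro a ha c hac
      rw [openGraph_adj] at hac
      obtain ⟨hmem, hne⟩ := hac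
      rcases Set.mem_insert_iff.mp hmem with heq | hS
      · rcases Sym2.eq_iff.mp heq with ⟨rfl, rfl⟩ | ⟨rfl, rfl⟩
        · exact hb₂
        · exact mem_openCluster_self ω₂ _
      · have hadj : (openGraph ω₂).Adj a c := by
          rw [openGraph_adj]; exact ⟨Set.mem_insert_of_mem _ (Set.mem_insert_of_mem _ hS), hne⟩
        exact SimpleGraph.Reachable.trans ha hadj.reachable

end Summit.CriticalPhenomena.PercolationContinuityZ3.Theorems.Coefficientwise.DigonClusters
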